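import Mathlib
import Literature.Computability.Complexity.CNF
import HarnessLib

/-!
# Complexity meta: the inner-product lift `φ ∘ IPₕⁿ` of a CNF

The standard *lifted* (composed) formula of query-to-communication / query-to-proof lifting:
given a CNF `φ` over variables `z₀, z₁, …` and a gadget width `h ≥ 1`, every variable `z_v` is
replaced by the inner-product gadget `IPₕ(a_v, b_v) = Σ_{i<h} a_{v,i} b_{v,i} (mod 2)` on a fresh
BLOCK of `2h` Boolean variables, and every clause `C` of `φ` (on the blocks of its variables) by the
canonical CNF of the Boolean function `y ↦ C(IP(y))` on those `2h·|vars C|` variables: one clause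
per falsifying assignment of the block variables (Garg–Göös–Kamath–Sokolov 2018, §2–3, "`F ∘ gⁿ`";
Alekseev–Itsykson 2025, §2 (lifted formulas `φ ∘ g` for Res(⊕)); Chattopadhyay–Filmus–Koroth–
Meir–Pitassi 2019/21 for the inner-product gadget at logarithmic block length).

* `ipCoord h v s i = (2v + s)·h + i` — the variable index of coordinate `i < h` on side
  `s ∈ {0,1}` (`a`-side / `b`-side) of block `v`; block `v` occupies the `2h` consecutive indices
  `2hv, …, 2hv + 2h − 1` (side `0` first);
* `ipBlockCoords h v` — that list of `2h` indices; `ipBlockValue h σ v : Bool` — the gadget output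
  `z_v = IPₕ(a_v, b_v)` under a total assignment `σ : ℕ → Bool` of the block variables;
* `liftClauseIP h C : CNF ℕ` — the canonical CNF of `C ∘ IP` on the blocks of `C`
  (`≤ 2^{2h·|C|}` clauses, each of width exactly `2h·|vars C|`);
* `liftIP φ h : CNF ℕ := φ.flatMap (liftClauseIP h)` — the lifted formula `φ ∘ IPₕ`.

The same coordinate dictionary `x = (2v+s)h + i ↔ (v, s, i)` is used by
`Literature.Computability.MetaComplexity.AffineDag` (points `Fin n → Fin 2 → Fin h → ZMod 2`).

## Mathlib / tree search

Nothing on lifted or composed CNFs in Mathlib; the tree has `XorificationLift.lean` (the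
XOR-substitution `φ[⊕ᵏ]` of Ben-Sasson, a different gadget) and `CNF`, `Clause`, `Literal`
(`Literature.Computability.Complexity.CNF`), on which we build. `Nat.testBit` enumerates block
assignments; `List.dedup`, `List.idxOf`, `List.mapIdx` are core.

## Design notes

* Purely syntactic and computable; no semantic lemma is stated here (the faithful-semantics
  lemma "`σ ⊨ liftIP φ h ↔ (v ↦ ipBlockValue h σ v) ⊨ φ`" and the size facts
  `numVars (liftIP φ h) ≤ 2h · numVars φ`, `(liftIP φ h).length ≤ φ.length · 2^{2h·k}` for a
  `k`-CNF are left to the users; they are routine inductions on the definitions below).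
* A clause mentioning a variable twice is handled through `dedup` of its variable list; a clause
  containing `z_v` and `¬z_v` has no falsifying gadget assignment and lifts to the empty CNF.
* The empty clause lifts to the CNF `[[]]` consisting of the empty clause (`2^0 = 1` assignment of
  no coordinates, vacuously falsifying).
* Junk: for `h = 0` every block value is `0` (empty sum); harmless, users assume `h ≥ 1`.

## References

* A. Garg, M. Göös, P. Kamath, D. Sokolov, *Monotone circuit lower bounds from resolution*,
  STOC 2018 / Theory Comput. 16 (2020), §2–3 (lifted CNF search problems `S(F) ∘ gⁿ`).
* Y. Alekseev, D. Itsykson, *Lifting to bounded-depth and regular resolutions over parities via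
  games*, STOC 2025, §2 (the lifted formula `φ ∘ g`, closure, games).
* A. Chattopadhyay, Y. Filmus, S. Koroth, O. Meir, T. Pitassi, *Query-to-communication lifting
  using low-discrepancy gadgets*, SIAM J. Comput. 50 (2021), Thm 1.2 (inner product with
  `b = Θ(log n)` bits per block).
-/

namespace Literature.Computability.MetaComplexity

open _root_.Computability Complexity

/-! ### Block coordinates and the gadget -/

/-- The variable index of coordinate `i < h` on side `s ∈ {0, 1}` of block `v` in the lifted
formula: `(2v + s)·h + i`, so that block `v` occupies the indices `2hv … 2hv + 2h − 1`, the
`a`-side (`s = 0`) first. [Garg–Göös–Kamath–Sokolov 2018, §2 (blocks of the lifted input)]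
[folklore] -/
def ipCoord (h v s i : ℕ) : ℕ :=
  (2 * v + s) * h + i

/-- The `2h` variable indices of block `v`, in increasing order (`a_{v,0} … a_{v,h-1}`,
`b_{v,0} … b_{v,h-1}`). [Garg–Göös–Kamath–Sokolov 2018, §2] [folklore] -/
def ipBlockCoords (h v : ℕ) : List ℕ :=
  (List.range (2 * h)).map fun j => 2 * h * v + j

/-- The inner-product gadget output of block `v` under a total assignment `σ` of the block
variables: `z_v = Σ_{i<h} a_{v,i} · b_{v,i} (mod 2)`, i.e. the parity of the number of `i < h`
with `a_{v,i} = b_{v,i} = 1`. [Chattopadhyay–Filmus–Koroth–Meir–Pitassi 2021, §1 (IP gadget);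
Garg–Göös–Kamath–Sokolov 2018, §2] [folklore] -/
def ipBlockValue (h : ℕ) (σ : ℕ → Bool) (v : ℕ) : Bool :=
  ((List.range h).filter fun i => σ (ipCoord h v 0 i) && σ (ipCoord h v 1 i)).length % 2 == 1

/-! ### The lifted clause and the lifted CNF -/

/-- The (deduplicated) list of variables of a clause, in order of first occurrence. [folklore] -/
def clauseBlocks (C : Clause ℕ) : List ℕ :=
  (C.map Prod.fst).dedup

/-- The list of block-variable indices of a clause: the blocks of its variables, `2h` indices
each, concatenated. [Garg–Göös–Kamath–Sokolov 2018, §2] [folklore] -/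
def clauseCoords (h : ℕ) (C : Clause ℕ) : List ℕ :=
  (clauseBlocks C).flatMap (ipBlockCoords h)

/-- The total assignment of block variables encoded by `m < 2^L` relative to a coordinate list
`xs` of length `L`: the `k`-th listed coordinate gets bit `k` of `m`; unlisted variables get
`false` (bit `L` and beyond of `m` when `m < 2^L`). [folklore] -/
def coordAssign (xs : List ℕ) (m : ℕ) : ℕ → Bool :=
  fun x => Nat.testBit m (xs.idxOf x)

/-- `m` encodes a FALSIFYING block assignment for the clause `C` at gadget width `h`: under the
gadget outputs it induces, every literal of `C` is false. [Garg–Göös–Kamath–Sokolov 2018, §2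
(`C ∘ g` as a CNF)] [folklore] -/
def IsFalsifyingCode (h : ℕ) (C : Clause ℕ) (m : ℕ) : Bool :=
  C.all fun l => ipBlockValue h (coordAssign (clauseCoords h C) m) l.1 == !l.2

/-- **The lifted clause** `C ∘ IPₕ` as a canonical CNF on the block variables of `C`: for every
falsifying code `m < 2^L` (`L = 2h·|vars C|`) the clause "the block variables differ from `m`
somewhere", i.e. the `k`-th listed coordinate with polarity `¬(bit k of m)`. Its set of satisfying
assignments is exactly `{σ | C is true under v ↦ ipBlockValue h σ v}`.
[Garg–Göös–Kamath–Sokolov 2018, §2–3; Alekseev–Itsykson 2025, §2] [folklore] -/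
def liftClauseIP (h : ℕ) (C : Clause ℕ) : CNF ℕ :=
  let xs := clauseCoords h C
  ((List.range (2 ^ xs.length)).filter (IsFalsifyingCode h C)).map fun m =>
    xs.mapIdx fun k x => (x, !(Nat.testBit m k))

/-- **The lifted CNF** `φ ∘ IPₕ`: the concatenation of the lifted clauses. For a `k`-CNF `φ` on
`n` variables it is a `2hk`-CNF on `2hn` variables with at most `|φ| · 2^{2hk}` clauses, and it is
satisfiable iff `φ` is (the gadget is onto). [Garg–Göös–Kamath–Sokolov 2018, §2–3 (`F ∘ gⁿ`);
Alekseev–Itsykson 2025, §2] [folklore] -/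
def liftIP (φ : CNF ℕ) (h : ℕ) : CNF ℕ :=
  φ.flatMap (liftClauseIP h)

end Literature.Computability.MetaComplexity
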